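import Summits.QuantumFields.YangMills.Theorems.IR.ShellMaxCorrDefs
import Literature.MathematicalPhysics.QuantumLattice.TorusWilsonMarkov
import Literature.MathematicalPhysics.QuantumLattice.WilsonPropagatorHeavyMass

/-!
# Crux `IR` (item stmt-QuantumFields-19354) — line «maximal correlation at one physical thickness»:
the BALL MARKOV PROPERTY of the torus Wilson state

Helper module for item `stmt-QuantumFields-19354` (`--supports … --as helper`; it closes nothing; lead prover
ym-ir-line-mxc-p1).  First input of the registered stub `ShellMaxCorr.stub_shellEngine : ShellEngine`
(`Theorems/IR/ShellMaxCorrDefs.lean`): the Markov property of Wilson's nearest-neighbour plaquette action across ONE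
SPHERE LAYER of the sup-distance on the torus `(ℤ/N)⁴`.

* §1 torus sup-distance geometry (`siteNorm`, `InBall`, `OutBall` of the Defs file): the distance from `0` on a cycle moves by
  at most one under `z ↦ z ± 1` (`ZMod.valMinAbs` minimality), hence all four vertices of a plaquette `(y; i, j)`, `i ≠ j`,
  are at mutual sup-distance `≤ 1` (`plaquette_layer`), and every link is in the closed ball `B_t` or outside the open ball
  (`inBall_or_outBall`).
* §2 `exists_layer_version` — for `μ = wilsonMeasure ρ β` (compact metrisable `G`, continuous `ρ`) and a bounded measurable
  `g` reading only links outside the open ball of radius `t`, there is a bounded measurable `g'` reading only the links of the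
  sphere layer `{InBall t ∧ OutBall t}` with `∫ f g dμ = ∫ f g' dμ` for every bounded measurable `f` reading only links of
  `B_t`.  Proof: the torus Wilson state is a DLR state of the plaquette specification
  (`Literature/MathematicalPhysics/QuantumLattice/TorusWilsonGibbs.lean`: `isGibbsMeasure_wilsonMeasure`); with the volume
  `Λ = {links not in B_t}` every plaquette meeting `Λ` lies in `Λ ∪ layer` (§1), so the DLR kernel average `γ_Λ g` is a
  layer-measurable version of `E_μ[g | links of B_t]`
  (`stronglyMeasurable_and_ae_eq_condExp_integral_gibbsSpecOfPotential`), and the pull-out property of conditional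
  expectation gives the identity.

No Yang–Mills input beyond nearest-neighbour structure; nothing here is specific to weak coupling.  HONEST FRAMING: a
measure-theoretic lemma toward ONE stub of a CONDITIONAL rung line; no mass-gap claim.

Refs: Georgii, *Gibbs Measures and Phase Transitions* (2011) Rem. 1.24, (2.11); Friedli–Velenik (2017) §6.3; Bradley,
*Basic properties of strong mixing conditions* (2005) §1.
-/

set_option autoImplicit false

noncomputable section

open Filter Topology MeasureTheory ProbabilityTheory
open Literature.MathematicalPhysics.QuantumFieldTheory Literature.MathematicalPhysics.QuantumLattice
open Literature.Probability.LatticeModels (gibbsSpecOfPotential IsGibbsMeasure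
  isSpecification_gibbsSpecOfPotential)

namespace Summit.QuantumFields.YangMills.Cruxes.IR.ShellMaxCorr

/-! ## §1 Geometry of the sup-distance on the torus -/

/-- The distance from `0` of `z` on the cycle `ℤ/N` is at most that of `z + 1` plus one (companion of the tree's
`natAbs_valMinAbs_add_one_le`). -/
theorem natAbs_valMinAbs_le_add_one {N : ℕ} [NeZero N] (z : ZMod N) :
    z.valMinAbs.natAbs ≤ (z + 1).valMinAbs.natAbs + 1 := by
  have h := natAbs_valMinAbs_sub_one_le (z + 1)
  rwa [add_sub_cancel_right] at h

/-- Coordinatewise comparison of sup-norms: if every coordinate distance of `x` is at most that of `x'` plus one, then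
`‖x‖ ≤ ‖x'‖ + 1`. -/
theorem siteNorm_le_succ_of_coords {N : ℕ} (x x' : Site 4 N)
    (h : ∀ k, ((x k).valMinAbs).natAbs ≤ ((x' k).valMinAbs).natAbs + 1) : siteNorm x ≤ siteNorm x' + 1 := by
  unfold siteNorm
  refine Finset.sup_le fun j _ => (h j).trans ?_
  exact Nat.add_le_add_right (Finset.le_sup (f := fun k => ((x' k).valMinAbs).natAbs) (Finset.mem_univ j)) 1

/-- Coordinates of a shifted site. -/
theorem shift_apply {N : ℕ} (x : Site 4 N) (k j : Fin 4) :
    (x.shift k) j = if j = k then x j + 1 else x j := by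
  simp only [Site.shift, Pi.add_apply, Pi.single_apply]
  split_ifs <;> simp

/-- `‖x + e_k‖ ≤ ‖x‖ + 1`. -/
theorem siteNorm_shift_le {N : ℕ} [NeZero N] (x : Site 4 N) (k : Fin 4) :
    siteNorm (x.shift k) ≤ siteNorm x + 1 := by
  refine siteNorm_le_succ_of_coords _ _ fun j => ?_
  rw [shift_apply]
  split_ifs
  · exact natAbs_valMinAbs_add_one_le (x j)
  · exact Nat.le_add_right _ _

/-- `‖x‖ ≤ ‖x + e_k‖ + 1`. -/
theorem siteNorm_le_shift {N : ℕ} [NeZero N] (x : Site 4 N) (k : Fin 4) :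
    siteNorm x ≤ siteNorm (x.shift k) + 1 := by
  refine siteNorm_le_succ_of_coords _ _ fun j => ?_
  rw [shift_apply]
  split_ifs
  · exact natAbs_valMinAbs_le_add_one (x j)
  · exact Nat.le_add_right _ _

/-- `‖x + e_i‖ ≤ ‖x + e_j‖ + 1` (two neighbours of the same site). -/
theorem siteNorm_shift_le_shift {N : ℕ} [NeZero N] (x : Site 4 N) (i j : Fin 4) :
    siteNorm (x.shift i) ≤ siteNorm (x.shift j) + 1 := by
  by_cases hij : i = j
  · subst hij; exact Nat.le_add_right _ _
  refine siteNorm_le_succ_of_coords _ _ fun k => ?_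
  rw [shift_apply, shift_apply]
  by_cases hki : k = i
  · subst hki
    rw [if_pos rfl, if_neg hij]
    exact natAbs_valMinAbs_add_one_le (x k)
  · rw [if_neg hki]
    by_cases hkj : k = j
    · subst hkj; rw [if_pos rfl]; exact natAbs_valMinAbs_le_add_one (x k)
    · rw [if_neg hkj]; exact Nat.le_add_right _ _

/-- `‖x‖ ≤ ‖x + e_i + e_j‖ + 1` for `i ≠ j`. -/
theorem siteNorm_le_shift_shift {N : ℕ} [NeZero N] (x : Site 4 N) {i j : Fin 4} (hij : i ≠ j) :
    siteNorm x ≤ siteNorm ((x.shift i).shift j) + 1 := by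
  refine siteNorm_le_succ_of_coords _ _ fun k => ?_
  rw [shift_apply, shift_apply]
  by_cases hkj : k = j
  · subst hkj
    rw [if_pos rfl, if_neg (Ne.symm hij)]
    exact natAbs_valMinAbs_le_add_one (x k)
  · rw [if_neg hkj]
    by_cases hki : k = i
    · subst hki; rw [if_pos rfl]; exact natAbs_valMinAbs_le_add_one (x k)
    · rw [if_neg hki]; exact Nat.le_add_right _ _

/-- `‖x + e_i + e_j‖ ≤ ‖x‖ + 1` for `i ≠ j`. -/
theorem siteNorm_shift_shift_le {N : ℕ} [NeZero N] (x : Site 4 N) {i j : Fin 4} (hij : i ≠ j) :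
    siteNorm ((x.shift i).shift j) ≤ siteNorm x + 1 := by
  refine siteNorm_le_succ_of_coords _ _ fun k => ?_
  rw [shift_apply, shift_apply]
  by_cases hkj : k = j
  · subst hkj
    rw [if_pos rfl, if_neg (Ne.symm hij)]
    exact natAbs_valMinAbs_add_one_le (x k)
  · rw [if_neg hkj]
    by_cases hki : k = i
    · subst hki; rw [if_pos rfl]; exact natAbs_valMinAbs_add_one_le (x k)
    · rw [if_neg hki]; exact Nat.le_add_right _ _

/-- Every link is in the closed ball `B_t` or outside the open ball of radius `t`. -/
theorem inBall_or_outBall {N : ℕ} [NeZero N] (t : ℕ) (e : Edge 4 N) : InBall t e ∨ OutBall t e := by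
  unfold InBall OutBall
  have h1 := siteNorm_shift_le e.1 e.2
  have h2 := siteNorm_le_shift e.1 e.2
  omega

/-- Shifts in two different directions commute. -/
theorem shift_shift_comm {N : ℕ} (x : Site 4 N) (i j : Fin 4) : (x.shift i).shift j = (x.shift j).shift i := by
  simp only [Site.shift]
  exact add_right_comm _ _ _

/-- **Plaquette geometry.**  For a plaquette `(y; i, j)` with `i ≠ j`: if one of its links is not in the ball `B_t`, then
every link of it which is in `B_t` lies in the sphere layer (it is also outside the open ball), because all four vertices
of a plaquette are at mutual sup-distance `≤ 1`. -/
theorem plaquette_layer {N : ℕ} [NeZero N] (t : ℕ) (y : Site 4 N) {i j : Fin 4} (hij : i ≠ j)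
    (e₀ e : Edge 4 N)
    (he₀ : e₀ ∈ ({(y, i), (y.shift i, j), (y.shift j, i), (y, j)} : Finset (Edge 4 N)))
    (he : e ∈ ({(y, i), (y.shift i, j), (y.shift j, i), (y, j)} : Finset (Edge 4 N)))
    (h₀ : ¬ InBall t e₀) : ¬ InBall t e ∨ (InBall t e ∧ OutBall t e) := by
  have h1 := siteNorm_shift_le y i
  have h2 := siteNorm_shift_le y j
  have h3 := siteNorm_le_shift y i
  have h4 := siteNorm_le_shift y j
  have h5 := siteNorm_shift_le_shift y i j
  have h6 := siteNorm_shift_le_shift y j i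
  have h7 := siteNorm_le_shift_shift y hij
  have h8 := siteNorm_shift_shift_le y hij
  have h9 := siteNorm_shift_le (y.shift i) j
  have h10 := siteNorm_le_shift (y.shift i) j
  have h11 := siteNorm_shift_le (y.shift j) i
  have h12 := siteNorm_le_shift (y.shift j) i
  have hcomm : (y.shift j).shift i = (y.shift i).shift j := (shift_shift_comm y i j).symm
  rw [hcomm] at h11 h12
  simp only [Finset.mem_insert, Finset.mem_singleton] at he₀ he
  rcases he₀ with rfl | rfl | rfl | rfl <;> rcases he with rfl | rfl | rfl | rfl <;>
    simp only [InBall, OutBall, hcomm] at h₀ ⊢ <;> omega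


/-! ## §2 The Markov property across the sphere layer -/

section Markov

variable {G : Type} [Group G] [TopologicalSpace G] [IsTopologicalGroup G] [CompactSpace G]
  [MeasurableSpace G] [BorelSpace G]

/-- Monotonicity of the balls in the radius. -/
theorem inBall_mono {N : ℕ} {t t' : ℕ} (h : t ≤ t') {e : Edge 4 N} (he : InBall t e) : InBall t' e :=
  ⟨he.1.trans h, he.2.trans h⟩

/-- Antitonicity of the outer regions in the radius. -/
theorem outBall_anti {N : ℕ} {t t' : ℕ} (h : t ≤ t') {e : Edge 4 N} (he : OutBall t' e) : OutBall t e :=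
  ⟨h.trans he.1, h.trans he.2⟩

/-- **Ball Markov property of the torus Wilson state, in integrated form.**  Let `μ = wilsonMeasure ρ β` on the torus
of side `N` (compact metrisable `G`, continuous `ρ`) and `t : ℕ`.  For every bounded measurable `g` depending only on the
links outside the open ball of radius `t` there is a bounded measurable `g'` depending only on the links of the SPHERE
LAYER `{e | InBall t e ∧ OutBall t e}` (a version of `E_μ[g | links of B_t]`, localised by the nearest-neighbour structure
of the plaquette action: a plaquette with a vertex outside `B_t` has all its vertices at distance `≥ t`) such that
`∫ f g dμ = ∫ f g' dμ` for every bounded measurable `f` depending only on the links of `B_t`. -/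
theorem exists_layer_version [T2Space G] [SecondCountableTopology G] {n : ℕ}
    (ρ : G →* Matrix (Fin n) (Fin n) ℂ) (hρ : Continuous ρ) (β : ℝ) (N : ℕ) [NeZero N] (t : ℕ)
    {g : GaugeConfig 4 N G → ℝ} (hgm : Measurable g) {C : ℝ} (hgC : ∀ U, |g U| ≤ C)
    (hg : DependsOn g {e | OutBall t e}) :
    ∃ g' : GaugeConfig 4 N G → ℝ, Measurable g' ∧ (∀ U, |g' U| ≤ C) ∧
      DependsOn g' {e | InBall t e ∧ OutBall t e} ∧
      ∀ f : GaugeConfig 4 N G → ℝ, Measurable f → (∃ Cf, ∀ U, |f U| ≤ Cf) → DependsOn f {e | InBall t e} →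
        ∫ U, f U * g U ∂(wilsonMeasure (d := 4) (L := N) ρ β) =
          ∫ U, f U * g' U ∂(wilsonMeasure (d := 4) (L := N) ρ β) := by
  classical
  set μ : Measure (GaugeConfig 4 N G) := wilsonMeasure (d := 4) (L := N) ρ β with hμ
  haveI : IsProbabilityMeasure μ := isProbabilityMeasure_wilsonMeasure (d := 4) (L := N) ρ hρ β
  obtain ⟨Φ, supp, hΦ, hΦb, hsupp, hH, hstruct⟩ := exists_plaquettePotential (d := 4) (L := N) ρ hρ
  have hGibbs : IsGibbsMeasure (gibbsSpecOfPotential (haarProbability G) Φ supp β) μ :=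
    isGibbsMeasure_wilsonMeasure ρ hρ hΦ hΦb hsupp hH β
  have hγ := isSpecification_gibbsSpecOfPotential (haarProbability G) hΦ hΦb hsupp β
  -- the volume: links NOT in the closed ball; the layer
  set Λ : Finset (Edge 4 N) := Finset.univ.filter fun e => ¬ InBall t e with hΛ
  set T : Set (Edge 4 N) := {e | InBall t e ∧ OutBall t e} with hT
  have hΛc : ((↑Λ : Set (Edge 4 N))ᶜ) = {e | InBall t e} := by
    ext e; simp [hΛ]
  have hmemΛ : ∀ e, e ∈ Λ ↔ ¬ InBall t e := fun e => by simp [hΛ]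
  -- geometry: a plaquette meeting `Λ` lies in `Λ ∪ T`
  have hTgeo : ∀ A ∈ supp Λ, (A ∩ Λ).Nonempty → (↑A : Set (Edge 4 N)) ⊆ ↑Λ ∪ T := by
    intro A hA hne
    obtain ⟨y, i, j, hij, rfl⟩ := hstruct Λ A hA
    obtain ⟨e₀, he₀⟩ := hne
    rw [Finset.mem_inter] at he₀
    intro e he
    have h := plaquette_layer t y (ne_of_lt hij) e₀ e he₀.1 (Finset.mem_coe.1 he) ((hmemΛ e₀).1 he₀.2)
    rcases h with h | h
    · exact Or.inl (Finset.mem_coe.2 ((hmemΛ e).2 h))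
    · exact Or.inr h
  -- `g` reads only links in `Λ ∪ T`
  have hgdep : DependsOn g (↑Λ ∪ T) := by
    refine hg.mono fun e he => ?_
    by_cases hin : InBall t e
    · exact Or.inr ⟨hin, he⟩
    · exact Or.inl (Finset.mem_coe.2 ((hmemΛ e).2 hin))
  obtain ⟨hwm, hwae⟩ := stronglyMeasurable_and_ae_eq_condExp_integral_gibbsSpecOfPotential
    (haarProbability G) hΦ hΦb hsupp β hGibbs Λ hTgeo hgm hgC hgdep
  set w : GaugeConfig 4 N G → ℝ := fun η => ∫ σ, g σ ∂(gibbsSpecOfPotential (haarProbability G) Φ supp β Λ η)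
    with hw
  have hwb : ∀ η, |w η| ≤ C := by
    intro η
    haveI := hγ.isProbability Λ η
    have hC0 : 0 ≤ C := (abs_nonneg _).trans (hgC η)
    have := norm_integral_le_of_norm_le_const
      (μ := gibbsSpecOfPotential (haarProbability G) Φ supp β Λ η) (f := g) (C := C)
      (ae_of_all _ fun σ => by rw [Real.norm_eq_abs]; exact hgC σ)
    simpa only [probReal_univ, mul_one, Real.norm_eq_abs] using this
  refine ⟨w, (hwm.mono cylinderEvents_le_pi).measurable, hwb,
    dependsOn_of_measurable_cylinderEvents_real hwm.measurable, ?_⟩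
  intro f hfm ⟨Cf, hfC⟩ hf
  -- `f` is measurable for the links of the ball = `Λᶜ`
  have hfm' : StronglyMeasurable[cylinderEvents (X := fun _ : Edge 4 N => G) ((↑Λ : Set (Edge 4 N))ᶜ)] f := by
    rw [hΛc]
    exact (hfm.measurable_cylinderEvents_of_dependsOn hf).stronglyMeasurable
  have hfi : Integrable f μ := Integrable.of_bound hfm.aestronglyMeasurable Cf
    (ae_of_all _ fun U => by rw [Real.norm_eq_abs]; exact hfC U)
  have hgi : Integrable g μ := Integrable.of_bound hgm.aestronglyMeasurable C
    (ae_of_all _ fun U => by rw [Real.norm_eq_abs]; exact hgC U)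
  have hfgi : Integrable (f * g) μ := by
    refine Integrable.of_bound (hfm.mul hgm).aestronglyMeasurable (Cf * C) (ae_of_all _ fun U => ?_)
    rw [Real.norm_eq_abs, Pi.mul_apply, abs_mul]
    exact mul_le_mul (hfC U) (hgC U) (abs_nonneg _) ((abs_nonneg _).trans (hfC U))
  have h1 : μ[f * g | cylinderEvents (X := fun _ : Edge 4 N => G) ((↑Λ : Set (Edge 4 N))ᶜ)] =ᵐ[μ]
      f * μ[g | cylinderEvents (X := fun _ : Edge 4 N => G) ((↑Λ : Set (Edge 4 N))ᶜ)] :=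
    condExp_mul_of_stronglyMeasurable_left hfm' hfgi hgi
  calc ∫ U, f U * g U ∂μ
      = ∫ U, (μ[f * g | cylinderEvents (X := fun _ : Edge 4 N => G) ((↑Λ : Set (Edge 4 N))ᶜ)]) U ∂μ :=
        (integral_condExp cylinderEvents_le_pi).symm
    _ = ∫ U, f U * (μ[g | cylinderEvents (X := fun _ : Edge 4 N => G) ((↑Λ : Set (Edge 4 N))ᶜ)]) U ∂μ :=
        integral_congr_ae (h1.mono fun U hU => by simpa using hU)
    _ = ∫ U, f U * w U ∂μ := by
        refine integral_congr_ae ?_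
        filter_upwards [hwae] with U hU
        rw [← hU]

end Markov


end Summit.QuantumFields.YangMills.Cruxes.IR.ShellMaxCorr

end
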